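import Summits.HubbardSuperconductivity.HubbardSuperconductivity.Theorems.AnisotropyChordCondensateSlabPolarised
import Summits.HubbardSuperconductivity.HubbardSuperconductivity.Theorems.AnisotropyChordXXZHoppingFormula
import Literature.Probability.LatticeModels.TorusBipartite

/-!
# Route `AnisotropyChord`, crux `ChordXY` (stmt-HubbardSuperconductivity-8146), line `condensate-slab`:
# the small-`β` curvature constant of the slab condensate is POSITIVE (`κ_M > 0`)

Notation: spin-½ `M × M` torus (`M` even), `H_M(Δ) = xxzHamiltonian 1 (torusGraph 2 M) (-1) Δ`,
`V = H_M(1) − H_M(0)` (the Ising part of the pencil `H_M(Δ) = H_M(0) + Δ V`; `V` is diagonal with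
entries `−Z(σ)`, `Z(σ) = Σ_{xy∈E} (½−σ_x)(½−σ_y)`), `φ = P₀𝟙 = 𝟙_{M²/2}` (half-filled indicator,
`sectorProj_mulVec_ones`), `A = condensateOp M = S⁺_tot S⁻_tot`, `a = (M²/2)(M²/2+1)` (`Aφ = aφ`).

The second-order coefficient of the small-`β` expansion of the slab condensate is a quadratic in `Δ`
with leading coefficient `q(Vφ)/‖φ‖²`, `q(x) = a‖x‖² − Re⟨x, Ax⟩`; this file proves `q(Vφ) > 0`:
* `slack_identity` — for a symmetric matrix `O` with entries in `ℝ≥0`, a finite set `W` with constant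
  row sums `Σ_{j∈W} O_ij = a` (`i ∈ W`) and `x` supported in `W`:
  `a‖x‖² − Re⟨x, Ox⟩ = ½ Σ_{i,j∈W} O_ij |x_i − x_j|²` (the Dirichlet form of the "teleport graph");
* `xxzPencil_mulVec_apply` — `(Vf)(σ) = −Z(σ) f(σ)`;
* the Néel configuration `σ₀` (parity colouring, `torusSiteParity`) is half-filled
  (`card_compl_evenSublattice`), has `Z(σ₀) = −|E|/4` termwise, and exchanging the spins at `0` and at
  `e₀ + 2e₁` produces a half-filled `τ₀` with a parallel edge `{0, e₀}`, so `Z(τ₀) > Z(σ₀)`, while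
  `A_{σ₀τ₀} ≥ 1` (one teleport move);
* **`slab_kappa_pos`** — `Re⟨Vφ, A Vφ⟩ < a · ⟨Vφ, Vφ⟩` for even `M ≥ 4`.

Sources: Tasaki (2020) §2.2, §2.4; Dyson–Lieb–Simon (1978) §2. Folklore; no definition; sorry-free.
HONEST: an input of the rung stub `stub_slabConcave_smallBeta`; nothing here proves `ChordXY`;
superconductivity in the Hubbard model is not advanced.
-/

set_option linter.dupNamespace false

noncomputable section

namespace Summit.HubbardSuperconductivity.HubbardSuperconductivity.Theorems.AnisotropyChord

open Matrix Complex Finset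
open scoped ComplexOrder
open Literature.MathematicalPhysics.QuantumLattice Literature.Probability.LatticeModels
open Summit.HubbardSuperconductivity.HubbardSuperconductivity.Theorems.AnisotropyChord.OneMagnon
  (xxz_mulVec_apply)

/-! ### The slack of the tangent bound: a Dirichlet form -/

/-- **Slack identity (Dirichlet form of the teleport graph).**  For a square complex matrix `O` with
entries in `ℝ≥0`, `O j i = O i j`, a finite set `W` on which the row sums `Σ_{j∈W} O i j` equal the
constant `a`, and a vector `x` supported in `W`:
`a·⟨x,x⟩ − Re⟨x, Ox⟩ = ½ Σ_{i∈W} Σ_{j∈W} O_ij |x_i − x_j|²`. [folklore] -/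
theorem slack_identity {ι : Type*} [Fintype ι] [DecidableEq ι] (O : Matrix ι ι ℂ)
    (hO : ∀ i j, 0 ≤ O i j) (hsymm : ∀ i j, O j i = O i j) (W : Finset ι) (a : ℝ)
    (hrow : ∀ i ∈ W, (∑ j ∈ W, O i j) = (a : ℂ)) (x : ι → ℂ) (hx : ∀ i, i ∉ W → x i = 0) :
    a * (star x ⬝ᵥ x).re - (star x ⬝ᵥ (O *ᵥ x)).re =
      (1 / 2) * ∑ i ∈ W, ∑ j ∈ W, (O i j).re * ‖x i - x j‖ ^ 2 := by
  -- real entries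
  have hex : ∃ o : ι → ι → ℝ, (∀ i j, o j i = o i j) ∧ ∀ i j, O i j = ((o i j : ℝ) : ℂ) := by
    refine ⟨fun i j => (O i j).re, fun i j => by
      show (O j i).re = (O i j).re
      rw [hsymm], fun i j => Complex.ext (by simp) ?_⟩
    have h := (Complex.le_def.mp (hO i j)).2
    simp only [Complex.zero_im] at h
    simp [← h]
  obtain ⟨o, ho_symm, hOeq⟩ := hex
  have hrow' : ∀ i ∈ W, (∑ j ∈ W, o i j) = a := by
    intro i hi
    have h := congrArg Complex.re (hrow i hi)
    rw [Complex.re_sum, Complex.ofReal_re] at h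
    simpa [hOeq] using h
  -- ⟨x,x⟩ restricted to W
  have hxx : (star x ⬝ᵥ x).re = ∑ i ∈ W, ‖x i‖ ^ 2 := by
    rw [dotProduct, Complex.re_sum, ← Finset.sum_subset (Finset.subset_univ W)]
    · refine Finset.sum_congr rfl fun i _ => ?_
      rw [Pi.star_apply, Complex.star_def, ← Complex.normSq_eq_conj_mul_self, Complex.normSq_eq_norm_sq]
      norm_cast
    · intro i _ hi
      rw [Pi.star_apply, hx i hi, mul_zero, Complex.zero_re]
  -- ⟨x,Ox⟩ restricted to W × W
  have hxOx : (star x ⬝ᵥ (O *ᵥ x)).re = ∑ i ∈ W, ∑ j ∈ W, o i j * ((starRingEnd ℂ) (x i) * x j).re := by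
    simp only [dotProduct, mulVec, Pi.star_apply, Finset.mul_sum, Complex.re_sum]
    rw [← Finset.sum_subset (Finset.subset_univ W)]
    · refine Finset.sum_congr rfl fun i _ => ?_
      rw [← Finset.sum_subset (Finset.subset_univ W)]
      · refine Finset.sum_congr rfl fun j _ => ?_
        rw [hOeq, Complex.star_def]
        have h : (starRingEnd ℂ) (x i) * (((o i j : ℝ) : ℂ) * x j) =
            ((o i j : ℝ) : ℂ) * ((starRingEnd ℂ) (x i) * x j) := by ring
        rw [h, Complex.re_ofReal_mul]
      · intro j _ hj
        rw [hx j hj, mul_zero, mul_zero, Complex.zero_re]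
    · intro i _ hi
      refine Finset.sum_eq_zero fun j _ => ?_
      rw [hx i hi, Complex.star_def, map_zero, zero_mul, Complex.zero_re]
  rw [hxx, hxOx]
  have norm_sub_sq_complex : ∀ u v : ℂ,
      ‖u - v‖ ^ 2 = ‖u‖ ^ 2 + ‖v‖ ^ 2 - 2 * ((starRingEnd ℂ) u * v).re := by
    intro u v
    rw [← Complex.normSq_eq_norm_sq, ← Complex.normSq_eq_norm_sq, ← Complex.normSq_eq_norm_sq,
      Complex.normSq_sub]
    congr 1
    rw [Complex.mul_re, Complex.conj_re, Complex.conj_im, Complex.mul_re, Complex.conj_re, Complex.conj_im]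
    ring
  have hR : ∑ i ∈ W, ∑ j ∈ W, (O i j).re * ‖x i - x j‖ ^ 2 =
      ∑ i ∈ W, ∑ j ∈ W, o i j * ‖x i‖ ^ 2 + ∑ i ∈ W, ∑ j ∈ W, o i j * ‖x j‖ ^ 2 -
        2 * ∑ i ∈ W, ∑ j ∈ W, o i j * ((starRingEnd ℂ) (x i) * x j).re := by
    rw [Finset.mul_sum, ← Finset.sum_add_distrib, ← Finset.sum_sub_distrib]
    refine Finset.sum_congr rfl fun i _ => ?_
    rw [Finset.mul_sum, ← Finset.sum_add_distrib, ← Finset.sum_sub_distrib]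
    refine Finset.sum_congr rfl fun j _ => ?_
    rw [hOeq, Complex.ofReal_re, norm_sub_sq_complex]
    ring
  -- the two "diagonal" pieces
  have h1 : ∑ i ∈ W, ∑ j ∈ W, o i j * ‖x i‖ ^ 2 = a * ∑ i ∈ W, ‖x i‖ ^ 2 := by
    rw [Finset.mul_sum]
    refine Finset.sum_congr rfl fun i hi => ?_
    rw [← Finset.sum_mul, hrow' i hi]
  have h2 : ∑ i ∈ W, ∑ j ∈ W, o i j * ‖x j‖ ^ 2 = a * ∑ i ∈ W, ‖x i‖ ^ 2 := by
    rw [Finset.sum_comm]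
    rw [Finset.mul_sum]
    refine Finset.sum_congr rfl fun j hj => ?_
    rw [← Finset.sum_mul]
    congr 1
    rw [← hrow' j hj]
    exact Finset.sum_congr rfl fun i _ => ho_symm j i
  rw [hR, h1, h2]
  ring

/-- Corollary: one teleport pair bounds the slack from below. [folklore] -/
theorem slack_ge_pair {ι : Type*} [Fintype ι] [DecidableEq ι] (O : Matrix ι ι ℂ)
    (hO : ∀ i j, 0 ≤ O i j) (hsymm : ∀ i j, O j i = O i j) (W : Finset ι) (a : ℝ)
    (hrow : ∀ i ∈ W, (∑ j ∈ W, O i j) = (a : ℂ)) (x : ι → ℂ) (hx : ∀ i, i ∉ W → x i = 0)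
    {i₀ j₀ : ι} (hi₀ : i₀ ∈ W) (hj₀ : j₀ ∈ W) :
    (1 / 2) * ((O i₀ j₀).re * ‖x i₀ - x j₀‖ ^ 2) ≤
      a * (star x ⬝ᵥ x).re - (star x ⬝ᵥ (O *ᵥ x)).re := by
  rw [slack_identity O hO hsymm W a hrow x hx]
  refine mul_le_mul_of_nonneg_left ?_ (by norm_num)
  have hnn : ∀ i j, 0 ≤ (O i j).re * ‖x i - x j‖ ^ 2 :=
    fun i j => mul_nonneg (Complex.le_def.mp (hO i j)).1 (sq_nonneg _)
  calc (O i₀ j₀).re * ‖x i₀ - x j₀‖ ^ 2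
      ≤ ∑ j ∈ W, (O i₀ j).re * ‖x i₀ - x j‖ ^ 2 :=
        Finset.single_le_sum (f := fun j => (O i₀ j).re * ‖x i₀ - x j‖ ^ 2) (fun j _ => hnn i₀ j) hj₀
    _ ≤ ∑ i ∈ W, ∑ j ∈ W, (O i j).re * ‖x i - x j‖ ^ 2 :=
        Finset.single_le_sum (f := fun i => ∑ j ∈ W, (O i j).re * ‖x i - x j‖ ^ 2)
          (fun i _ => Finset.sum_nonneg fun j _ => hnn i j) hi₀

/-! ### The Ising part of the pencil is diagonal -/

/-- **`(H_M(1) − H_M(0)) f (σ) = −Z(σ) f(σ)`**: the Ising part of the XXZ pencil is the diagonal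
matrix of minus the Ising energy `Z(σ) = Σ_{xy∈E}(½−σ_x)(½−σ_y)` (from the hopping formula
`xxz_mulVec_apply`). Tasaki (2020) §2.4. [folklore] -/
theorem xxzPencil_mulVec_apply {V : Type*} [Fintype V] [DecidableEq V] (G : SimpleGraph V)
    [DecidableRel G.Adj] (f : (V → Fin 2) → ℂ) (σ : V → Fin 2) :
    ((xxzHamiltonian 1 G (-1) 1 - xxzHamiltonian 1 G (-1) 0 : Op V 2) *ᵥ f) σ =
      -((∑ e ∈ G.edgeFinset, Sym2.lift ⟨fun x y => ((1 : ℝ) / 2 - (σ x : ℕ)) * ((1 : ℝ) / 2 - (σ y : ℕ)),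
          fun _ _ => mul_comm _ _⟩ e : ℝ) : ℂ) * f σ := by
  rw [sub_mulVec, Pi.sub_apply, xxz_mulVec_apply, xxz_mulVec_apply]
  push_cast
  ring

/-! ### The Néel pair on the even torus -/

section Neel

variable (M : ℕ) [NeZero M]

/-- The half-filled configurations have as many down spins as the odd sublattice has sites:
for the Néel (parity) configuration the weight is `M²/2`. Dyson–Lieb–Simon (1978) §2. [folklore] -/
theorem neel_weight (hM : 2 ∣ M) :
    (∑ z, (((fun x : TorusSite 2 M => if torusSiteParity hM x = 0 then (0 : Fin 2) else 1) z : Fin 2) : ℕ))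
      = M ^ 2 / 2 := by
  rw [← card_filter_eq_one_eq_weight]
  have hset : (Finset.univ.filter fun x : TorusSite 2 M =>
      (if torusSiteParity hM x = 0 then (0 : Fin 2) else 1) = 1) = (evenSublattice (d := 2) M hM)ᶜ := by
    ext x
    simp only [Finset.mem_filter, Finset.mem_univ, true_and, Finset.mem_compl, mem_evenSublattice_iff]
    by_cases h : torusSiteParity hM x = 0
    · simp [h]
    · simp [h]
  rw [hset]
  have hcard := card_compl_evenSublattice (d := 2) M hM 0
  have htot : (evenSublattice (d := 2) M hM)ᶜ.card + (evenSublattice (d := 2) M hM).card = M ^ 2 := by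
    rw [Finset.card_compl_add_card]
    simp [Fintype.card_pi, ZMod.card]
  omega

omit [NeZero M] in
/-- Along an edge of the even torus the Néel spins are opposite, so the Ising term is `−¼`.
[folklore] -/
theorem neel_edge_term (hM : 2 ∣ M) {x y : TorusSite 2 M} (hxy : (torusGraph 2 M).Adj x y) :
    ((1 : ℝ) / 2 - (((fun x : TorusSite 2 M => if torusSiteParity hM x = 0 then (0 : Fin 2) else 1) x
        : Fin 2) : ℕ)) *
      ((1 : ℝ) / 2 - (((fun x : TorusSite 2 M => if torusSiteParity hM x = 0 then (0 : Fin 2) else 1) y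
        : Fin 2) : ℕ)) = -(1 / 4) := by
  have hflip := torusSiteParity_of_adj hM hxy
  have h01 : ∀ t : ZMod 2, t = 0 ∨ t = 1 := by decide
  simp only
  rcases h01 (torusSiteParity hM x) with h0 | h1
  · have hy : torusSiteParity hM y ≠ 0 := by rw [hflip, h0]; decide
    rw [if_pos h0, if_neg hy]
    norm_num
  · have hx : torusSiteParity hM x ≠ 0 := by rw [h1]; decide
    have hy : torusSiteParity hM y = 0 := by rw [hflip, h1]; decide
    rw [if_neg hx, if_pos hy]
    norm_num

omit [NeZero M] in
/-- Any Ising term of a spin-½ configuration is `≥ −¼`. [folklore] -/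
theorem edge_term_ge (σ : TorusSite 2 M → Fin 2) (x y : TorusSite 2 M) :
    -(1 / 4 : ℝ) ≤ ((1 : ℝ) / 2 - (σ x : ℕ)) * ((1 : ℝ) / 2 - (σ y : ℕ)) := by
  have h2 : ∀ t : Fin 2, (t : ℕ) = 0 ∨ (t : ℕ) = 1 := by
    intro t
    rcases Fin.eq_zero_or_eq_succ t with h | ⟨j, hj⟩
    · left; rw [h]; rfl
    · right; rw [hj, Fin.eq_zero j]; rfl
  rcases h2 (σ x) with hx | hx <;> rcases h2 (σ y) with hy | hy <;> rw [hx, hy] <;> norm_num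

end Neel

/-! ### `κ_M > 0` -/

/-- **The small-`β` curvature constant of the slab condensate is positive**: for even `M ≥ 4`,
with `φ = P₀𝟙`, `V = H_M(1) − H_M(0)` and `a = (M²/2)(M²/2+1)`,
`Re⟨Vφ, S⁺_tot S⁻_tot Vφ⟩ < a · ⟨Vφ, Vφ⟩` — i.e. `Vφ` is not in the top eigenspace of the
condensate operator on the half-filled sector.  Proof: the slack identity bounds the difference from
below by the contribution of the single teleport pair (Néel `σ₀`, `τ₀ = σ₀ ∘ swap(0, e₀+2e₁)`), for which
`(S⁺S⁻)_{σ₀τ₀} ≥ 1` and `Z(σ₀) = −|E|/4 < Z(τ₀)` (the edge `{0, e₀}` is parallel in `τ₀`). [folklore] -/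
theorem slab_kappa_pos (M : ℕ) [NeZero M] (hM : Even M) (h4 : 4 ≤ M) :
    (star ((xxzHamiltonian 1 (torusGraph 2 M) (-1) 1 - xxzHamiltonian 1 (torusGraph 2 M) (-1) 0) *ᵥ
          (sectorProj M *ᵥ fun _ => (1 : ℂ))) ⬝ᵥ
        (condensateOp M *ᵥ
          ((xxzHamiltonian 1 (torusGraph 2 M) (-1) 1 - xxzHamiltonian 1 (torusGraph 2 M) (-1) 0) *ᵥ
            (sectorProj M *ᵥ fun _ => (1 : ℂ))))).re <
      (((M ^ 2 / 2 : ℕ) : ℝ) * (((M ^ 2 / 2 : ℕ) : ℝ) + 1)) *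
        (star ((xxzHamiltonian 1 (torusGraph 2 M) (-1) 1 - xxzHamiltonian 1 (torusGraph 2 M) (-1) 0) *ᵥ
            (sectorProj M *ᵥ fun _ => (1 : ℂ))) ⬝ᵥ
          ((xxzHamiltonian 1 (torusGraph 2 M) (-1) 1 - xxzHamiltonian 1 (torusGraph 2 M) (-1) 0) *ᵥ
            (sectorProj M *ᵥ fun _ => (1 : ℂ)))).re := by
  have hM2 : 2 ∣ M := even_iff_two_dvd.mp hM
  haveI : Fact (1 < M) := ⟨by omega⟩
  set G := torusGraph 2 M with hGdef
  set Wn : ℕ := M ^ 2 / 2 with hWn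
  set a : ℝ := ((M ^ 2 / 2 : ℕ) : ℝ) * (((M ^ 2 / 2 : ℕ) : ℝ) + 1) with ha
  set A := condensateOp M with hAdef
  set Vm : Op (TorusSite 2 M) 2 :=
    xxzHamiltonian 1 (torusGraph 2 M) (-1) 1 - xxzHamiltonian 1 (torusGraph 2 M) (-1) 0 with hVm
  set φ : TensorIndex (TorusSite 2 M) 2 → ℂ := sectorProj M *ᵥ fun _ => (1 : ℂ) with hφdef
  set Zf : (TorusSite 2 M → Fin 2) → ℝ := fun σ =>
    ∑ e ∈ G.edgeFinset, Sym2.lift ⟨fun x y => ((1 : ℝ) / 2 - (σ x : ℕ)) * ((1 : ℝ) / 2 - (σ y : ℕ)),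
      fun _ _ => mul_comm _ _⟩ e with hZf
  set W : Finset (TorusSite 2 M → Fin 2) := Finset.univ.filter fun σ => (∑ z, (σ z : ℕ)) = Wn with hW
  have hmemW : ∀ σ, σ ∈ W ↔ (∑ z, (σ z : ℕ)) = Wn := fun σ => by simp [hW]
  have hφ_apply : ∀ σ, φ σ = if (∑ z, (σ z : ℕ)) = Wn then 1 else 0 :=
    fun σ => sectorProj_mulVec_ones_apply M hM σ
  set x : TensorIndex (TorusSite 2 M) 2 → ℂ := Vm *ᵥ φ with hxdef
  have hx_apply : ∀ σ, x σ = -((Zf σ : ℝ) : ℂ) * φ σ := fun σ => by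
    rw [hxdef, hVm, xxzPencil_mulVec_apply]
  have hx_off : ∀ σ, σ ∉ W → x σ = 0 := fun σ hσ => by
    rw [hx_apply, hφ_apply, if_neg (fun h => hσ ((hmemW σ).mpr h)), mul_zero]
  have hx_on : ∀ σ, σ ∈ W → x σ = -((Zf σ : ℝ) : ℂ) := fun σ hσ => by
    rw [hx_apply, hφ_apply, if_pos ((hmemW σ).mp hσ), mul_one]
  have hrow : ∀ σ ∈ W, (∑ τ ∈ W, A σ τ) = (a : ℂ) := by
    intro σ hσ
    have h := congrFun (condensateOp_mulVec_sectorProj_ones M hM) σ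
    rw [Pi.smul_apply, smul_eq_mul, sectorProj_mulVec_ones_apply M hM σ, if_pos ((hmemW σ).mp hσ),
      mul_one, mulVec, dotProduct] at h
    rw [← h, ← Finset.sum_subset (Finset.subset_univ W)]
    · refine Finset.sum_congr rfl fun τ hτ => ?_
      rw [sectorProj_mulVec_ones_apply M hM τ, if_pos ((hmemW τ).mp hτ), mul_one]
    · intro τ _ hτ
      rw [sectorProj_mulVec_ones_apply M hM τ, if_neg (fun h => hτ ((hmemW τ).mpr h)), mul_zero]
  set σ₀ : TorusSite 2 M → Fin 2 := fun p => if torusSiteParity hM2 p = 0 then 0 else 1 with hσ₀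
  set p₀ : TorusSite 2 M := 0 with hp₀
  set n₀ : TorusSite 2 M := 0 + Pi.single 0 1 with hn₀
  set p₁ : TorusSite 2 M := 0 + Pi.single 0 1 + Pi.single 1 1 + Pi.single 1 1 with hp₁
  set τ₀ : TorusSite 2 M → Fin 2 := σ₀ ∘ Equiv.swap p₀ p₁ with hτ₀
  have h11 : (1 : ZMod 2) + 1 = 0 := by decide
  have hpar_p₀ : torusSiteParity hM2 p₀ = 0 := by
    simp [hp₀, Literature.Probability.LatticeModels.torusSiteParity]
  have hpar_n₀ : torusSiteParity hM2 n₀ = 1 := by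
    rw [hn₀, Literature.Probability.LatticeModels.torusSiteParity_add_single, hpar_p₀, zero_add]
  have hpar_p₁ : torusSiteParity hM2 p₁ = 1 := by
    rw [hp₁, Literature.Probability.LatticeModels.torusSiteParity_add_single,
      Literature.Probability.LatticeModels.torusSiteParity_add_single,
      Literature.Probability.LatticeModels.torusSiteParity_add_single, hpar_p₀, zero_add, add_assoc, h11,
      add_zero]
  have h10 : (1 : ZMod 2) ≠ 0 := by decide
  have hσp₀ : σ₀ p₀ = 0 := by simp only [hσ₀, hpar_p₀, if_true]
  have hσn₀ : σ₀ n₀ = 1 := by simp only [hσ₀, hpar_n₀, if_neg h10]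
  have hσp₁ : σ₀ p₁ = 1 := by simp only [hσ₀, hpar_p₁, if_neg h10]
  have hp₀p₁ : p₀ ≠ p₁ := fun h => by
    have := hpar_p₀; rw [h, hpar_p₁] at this; exact h10 this
  have hn₀p₀ : n₀ ≠ p₀ := fun h => by
    have := hpar_n₀; rw [h, hpar_p₀] at this; exact h10 this.symm
  have h2M : (2 : ZMod M) ≠ 0 := by
    intro h
    have h' : ((2 : ℕ) : ZMod M) = 0 := by exact_mod_cast h
    rw [ZMod.natCast_eq_zero_iff] at h'
    have := Nat.le_of_dvd (by norm_num) h'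
    omega
  have hn₀p₁ : n₀ ≠ p₁ := by
    intro h
    have h1 := congrFun h 1
    simp only [hn₀, hp₁, Pi.add_apply, Pi.single_eq_same, Pi.zero_apply,
      Pi.single_eq_of_ne (one_ne_zero : (1 : Fin 2) ≠ 0)] at h1
    apply h2M
    have h2 : (1 : ZMod M) + 1 = 2 := by norm_num
    rw [← h2]
    have := h1.symm
    simpa using this
  have hτp₀ : τ₀ p₀ = 1 := by
    simp only [hτ₀, Function.comp_apply, Equiv.swap_apply_left, hσp₁]
  have hτn₀ : τ₀ n₀ = 1 := by
    simp only [hτ₀, Function.comp_apply, Equiv.swap_apply_of_ne_of_ne hn₀p₀ hn₀p₁, hσn₀]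
  have hσ₀W : σ₀ ∈ W := by
    rw [hmemW]
    exact neel_weight M hM2
  have hτ₀W : τ₀ ∈ W := by
    rw [hmemW, ← (hmemW σ₀).mp hσ₀W, hτ₀]
    exact Equiv.sum_comp (Equiv.swap p₀ p₁) (fun z => ((σ₀ z : Fin 2) : ℕ))
  have hadj : G.Adj p₀ n₀ := by
    rw [hGdef, torusGraph_adj_iff]
    exact ⟨hn₀p₀.symm, Or.inl ⟨0, by rw [hn₀, hp₀]⟩⟩
  have hZlt : Zf σ₀ < Zf τ₀ := by
    simp only [hZf]
    refine Finset.sum_lt_sum (fun e he => ?_) ⟨s(p₀, n₀), ?_, ?_⟩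
    · revert he
      induction e using Sym2.ind with
      | h u v =>
        intro he
        rw [SimpleGraph.mem_edgeFinset, SimpleGraph.mem_edgeSet] at he
        simp only [Sym2.lift_mk]
        rw [neel_edge_term M hM2 he]
        exact edge_term_ge M τ₀ u v
    · rw [SimpleGraph.mem_edgeFinset, SimpleGraph.mem_edgeSet]; exact hadj
    · simp only [Sym2.lift_mk]
      rw [neel_edge_term M hM2 hadj, hτp₀, hτn₀]
      norm_num
  have hxne : x σ₀ ≠ x τ₀ := by
    rw [hx_on σ₀ hσ₀W, hx_on τ₀ hτ₀W]
    intro h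
    have h' : (Zf σ₀ : ℝ) = Zf τ₀ := by
      have := congrArg Neg.neg h
      simp only [neg_neg] at this
      exact_mod_cast this
    exact hZlt.ne h'
  set ρ₀ : TorusSite 2 M → Fin 2 := Function.update σ₀ p₀ 1 with hρ₀
  have hraise : (1 : ℂ) ≤ (∑ y : TorusSite 2 M, onSite y (spinRaise 1)) σ₀ ρ₀ := by
    rw [Matrix.sum_apply]
    have hterm : (onSite p₀ (spinRaise 1) : Op (TorusSite 2 M) 2) σ₀ ρ₀ = 1 := by
      rw [onSite_apply]
      have hcond : ∀ y, y ≠ p₀ → σ₀ y = ρ₀ y := fun y hy => by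
        rw [hρ₀, Function.update_of_ne hy]
      rw [if_pos hcond, hσp₀, hρ₀, Function.update_self, spinRaise_apply]
      simp
    calc (1 : ℂ) = (onSite p₀ (spinRaise 1) : Op (TorusSite 2 M) 2) σ₀ ρ₀ := hterm.symm
      _ ≤ ∑ y, (onSite y (spinRaise 1) : Op (TorusSite 2 M) 2) σ₀ ρ₀ :=
          Finset.single_le_sum (f := fun y => (onSite y (spinRaise 1) : Op (TorusSite 2 M) 2) σ₀ ρ₀)
            (fun y _ => onSite_apply_nonneg y _ (spinRaise_apply_nonneg 1) σ₀ ρ₀) (Finset.mem_univ p₀)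
  have hlower : (1 : ℂ) ≤ (∑ y : TorusSite 2 M, onSite y (spinLower 1)) ρ₀ τ₀ := by
    rw [Matrix.sum_apply]
    have hterm : (onSite p₁ (spinLower 1) : Op (TorusSite 2 M) 2) ρ₀ τ₀ = 1 := by
      rw [onSite_apply]
      have hcond : ∀ y, y ≠ p₁ → ρ₀ y = τ₀ y := by
        intro y hy
        by_cases hy0 : y = p₀
        · rw [hy0, hρ₀, Function.update_self, hτp₀]
        · rw [hρ₀, Function.update_of_ne hy0, hτ₀, Function.comp_apply,
            Equiv.swap_apply_of_ne_of_ne hy0 hy]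
      rw [if_pos hcond, hρ₀, Function.update_of_ne (Ne.symm hp₀p₁), hσp₁, hτ₀, Function.comp_apply,
        Equiv.swap_apply_right, hσp₀, spinLower_eq_conjTranspose, conjTranspose_apply, spinRaise_apply]
      simp
    calc (1 : ℂ) = (onSite p₁ (spinLower 1) : Op (TorusSite 2 M) 2) ρ₀ τ₀ := hterm.symm
      _ ≤ ∑ y, (onSite y (spinLower 1) : Op (TorusSite 2 M) 2) ρ₀ τ₀ :=
          Finset.single_le_sum (f := fun y => (onSite y (spinLower 1) : Op (TorusSite 2 M) 2) ρ₀ τ₀)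
            (fun y _ => onSite_apply_nonneg y _ (spinLower_apply_nonneg 1) ρ₀ τ₀) (Finset.mem_univ p₁)
  have hA1 : (1 : ℂ) ≤ A σ₀ τ₀ := by
    rw [hAdef, condensateOp_eq, Matrix.mul_apply]
    have h01 : (0 : ℂ) ≤ 1 := zero_le_one
    calc (1 : ℂ) = 1 * 1 := (mul_one 1).symm
      _ ≤ (∑ y : TorusSite 2 M, onSite y (spinRaise 1)) σ₀ ρ₀ *
            (∑ y : TorusSite 2 M, onSite y (spinLower 1)) ρ₀ τ₀ :=
          mul_le_mul hraise hlower h01 (h01.trans hraise)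
      _ ≤ ∑ ρ, (∑ y : TorusSite 2 M, onSite y (spinRaise 1)) σ₀ ρ *
            (∑ y : TorusSite 2 M, onSite y (spinLower 1)) ρ τ₀ :=
          Finset.single_le_sum (f := fun ρ => (∑ y : TorusSite 2 M, onSite y (spinRaise 1)) σ₀ ρ *
            (∑ y : TorusSite 2 M, onSite y (spinLower 1)) ρ τ₀)
            (fun ρ _ => mul_nonneg (raiseTot_apply_nonneg 1 σ₀ ρ) (lowerTot_apply_nonneg 1 ρ τ₀))
            (Finset.mem_univ ρ₀)
  have hA1re : (1 : ℝ) ≤ (A σ₀ τ₀).re := by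
    have := (Complex.le_def.mp hA1).1
    simpa using this
  have hAnn : ∀ i j, 0 ≤ A i j := fun i j => by rw [hAdef, condensateOp_eq]; exact condensate_apply_nonneg 1 i j
  have hAsymm : ∀ i j, A j i = A i j := fun i j => by rw [hAdef, condensateOp_eq]; exact condensate_apply_symm 1 i j
  have hpair := slack_ge_pair A hAnn hAsymm W a hrow x hx_off hσ₀W hτ₀W
  have hpos : 0 < (1 / 2) * ((A σ₀ τ₀).re * ‖x σ₀ - x τ₀‖ ^ 2) := by
    have hn : 0 < ‖x σ₀ - x τ₀‖ := norm_pos_iff.mpr (sub_ne_zero.mpr hxne)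
    have : 0 < (A σ₀ τ₀).re := by linarith
    positivity
  linarith
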